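import Summits.Ventures.Crystal3D.Bulk.RobinsonShellTables
import Summits.AtomisticToContinuum.Crystallization.Theorems.BrittleRungDescentSoftLayerPropagationCovering
import HarnessLib

/-!
# Twelve unit balls touching a unit ball: a counterexample to Robinson's conjecture on the least
# distance of non-abutting balls (L. Fejes Tóth 1969, p. 444) — proved

Venture `Summits/Ventures/Crystal3D` (pub-crystal3d cell), topic `Bulk` (the twelve-ball shell /
BIMODAL side). A NEW result of the cell (the closed form and the refutation are not in print; placed
under `Summits/` by the placement rule, the refuted conjecture being cited from its printed source),
in the vocabulary of `Literature/…/FejesTothKissingTwelve.lean` (the twelve-neighbour packings of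
Hales 2012, the patterns `fccKissingPattern` / `hcpKissingPattern` of `KissingPatterns.lean`, and
the congruence notion `IsArrangedIn`). Theorem-and-helpers only: no named fact, nothing assumed.

## Source, as printed

L. Fejes Tóth, *Remarks on a theorem of R. M. Robinson*, Studia Sci. Math. Hungar. **4** (1969)
441–445 [`FejesToth1969Robinson`], p. 444, verbatim (radius-1 units: unit balls, touching ⇔
centres at distance `2`):

"It may be conjectured that in Euclidean 3-space all maximal sphere-packings are built up of
hexagonal layers, so that the Dirichlet-cell of each sphere is either a rhombic or a
trapezo-rhombic dodecahedron [4, p. 295]. This conjecture may be supported by the following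
considerations. Let `u` be a unit ball, and `u₁, …, u₁₂` twelve unit balls touching `u`. Since a
further unit ball `u₁₃` cannot touch `u`, the centers of `u` and `u₁₃` have a distance greater
than `2`. The minimum, `D`, of this distance for all possible arrangements of `u₁, …, u₁₃` is
conjectured to be `14/√27 = 2·69…` [4, p. 297]. Both in the rhombic and trapezo-rhombic
arrangement each of the balls `u₁, …, u₁₂` is fixed by the others. Now the least distance between
the centers of non-abutting balls equals `√8`, which, of course, is greater than `D`. But it seems
very likely that in any other position some of the balls `u₁, …, u₁₂` have a little play, so that
there will be two non-abutting balls the centers of which have a distance less than `D`, thus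
hindering each other to be touched by twelve unit balls. To recapitulate, we formulate the
following problem: In a certain arrangement of `u₁, …, u₁₂` other than the rhombic or
trapezo-rhombic arrangement, let `d` be the least distance between the centers of non-abutting
balls. Prove (or disprove) that `d < D`. After I called the attention of Professor Robinson to this
problem, he soon proved that `d < 2.54`, so that the desired result concerning maximal
sphere-packings would be obtained by proving that `D > 2.54`. Robinson made the conjecture that
the maximum of `d` is equal to `√((42 − 2√57)/5) ≈ 2.32`. This bound is attained when the points
of tangency of `u` and `u₁, …, u₁₂` consist of the vertices of an equilateral triangle of
side-length `60°` centered at the north pole, of the images of the vertices reflected in the sides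
and the images of these six points obtained by a glide-reflection in and along the equator which
carries the three southernmost points of the northern hemisphere `60°` from their original
positions."

The "rhombic" / "trapezo-rhombic arrangement" is the one whose Dirichlet cell is the rhombic /
trapezo-rhombic dodecahedron, i.e. whose twelve centres form the cuboctahedron (FCC shell) / the
anticuboctahedron (HCP shell): in the tree, `2 · fccKissingPattern` / `2 · hcpKissingPattern` up
to a linear isometry (`IsArrangedIn`, `FejesTothKissingTwelve.lean`). Robinson's arrangement
(reconstructed numerically by the AtomisticToContinuum/Crystal3D cell, 2026-08-22: an isostatic
arrangement with `21` contacts) indeed has `d = 2.319497… = √((42 − 2√57)/5)`, least non-contact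
angle `70.8834°`.

## What is proved: the conjectured value `max d = √((42 − 2√57)/5)` is FALSE

* `exists_twelve_balls_nonAbutting_dist` (**the counterexample**): there is a twelve-point set
  `S` on the sphere `‖x‖ = 2` (the centres of twelve unit balls touching the unit ball at `0`),
  NOT arranged in the FCC pattern and NOT arranged in the HCP pattern, in which every pair of
  distinct centres is at distance exactly `2` (abutting balls) or at distance
  `≥ d_M := √((928 − 80√19)/107) = 2.32678…`, and `d_M` is attained by a non-abutting pair;
  so `d(S) = d_M`.
* `robinsonBound_lt` : `√((42 − 2√57)/5) < √((928 − 80√19)/107)`, with the decimal brackets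
  `robinsonBound_mem_Ioo` (`2.3194 < √((42 − 2√57)/5) < 2.3195`) and `rbMinDist_mem_Ioo`
  (`2.3267 < d_M < 2.3268`);
* `exists_twelve_balls_nonAbutting_gt_robinsonBound` (the two combined, in the words of the
  source): an arrangement other than the rhombic or trapezo-rhombic one whose least distance
  between centres of non-abutting balls EXCEEDS Robinson's conjectured maximum — by `0.0073`
  (`0.31 %`; least non-contact angle `71.1397°` against `70.8834°`).

HONEST FRAMING. This refutes only the conjectured VALUE of `max d` printed on p. 444; it neither
touches Fejes Tóth's problem "`d < D`" (the twelve-neighbour / hexagonal-layer conjecture, now the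
theorems of Hales 2012 [`Hales2012`] and Böröczky–Szabó 2015) nor determines `max d`.

## The arrangement (closed form)

It is the twelve-ball shell of a rigid cluster of thirteen balls with `34` contacts from
Holmes-Cerfon's enumeration of rigid sphere packings [`HolmesCerfon2016`; data set `n = 13`,
line 70530 of the author's coordinate file `n13.txt`], spotted by the Crystal3D cell as the
twelve-neighbour shell with the largest least non-contact distance among the `737` rigid shells
of that list (screen value `71.1397°`), and solved here in closed form. Its symmetry group is
`D₂ = {1, g, h, gh}`, `g = diag(1,−1,−1)`, `h = diag(−1,1,−1)`, and it is the union of the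
`D₂`-orbits of three points. With `t = √19` and `p = √((67 − 15√19)/856)`, and all coordinates
to be divided by `9` (so that `‖·‖ = 2`):

* `A′ = (6p(25 + 4t), √3, √6·p(67 + 15t))`,
* `B′ = (18p, 9√3, 9√6·p(5 + t))`,
* `C′ = (36p(5 + t), 6√3, −12√6·p)`

(indices below: `0,1,2,3 = A′, ghA′, hA′, gA′`; `4,5,6,7 = B′, hB′, gB′, ghB′`;
`8,9,10,11 = C′, gC′, hC′, ghC′`). The strips `A′C′B′(hB′)(hC′)(hA′)` and its `g`-image are
chains of four equilateral spherical triangles of side `60°`, linked by the four contacts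
`A′–gC′, gA′–C′, ghA′–hC′, hA′–ghC′`; in all `22` contacts — the `D₂`-orbits of
`A′B′, A′C′, A′(gC′), B′C′, B′(hC′)` (four each) and of `B′(hB′)` (two) — with contact degrees
`3` on the orbit of `A′` and `4` elsewhere (the FCC and HCP shells have `24` contacts). All `66`
inner products lie in `ℚ(√19)`; the largest non-contact one is `⟪C′, gC′⟫/324 = (10√19 − 9)/107
= 0.32326…`, whence `d_M² = 8 − 8(10√19 − 9)/107 = (928 − 80√19)/107`.

Proof technique. The `3 + 21` `D₂`-classes of inner products are polynomial identities in
`t, √3, √6, p` modulo `t² = 19`, `(√3)² = 3`, `(√6)² = 6`, `856p² = 67 − 15t`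
(`linear_combination`; cofactors computed with a computer algebra system, exact rationals); the
`144` ordered pairs are dispatched by `fin_cases` + `linarith` from the class identities and
`4.35889 < √19 < 4.3589`. Non-congruence to FCC/HCP: a set arranged in either pattern is a kissing
configuration in Hales's sense (the tree's `isKissingConfig_of_isArrangedIn`: distinct points at
distance `2` or `≥ 2h₀ = 2.52`, in fact `2` or `≥ 2√2`), whereas `2 < d_M < 2.52`.

## References
* L. Fejes Tóth, Studia Sci. Math. Hungar. 4 (1969) 441–445, p. 444. [`FejesToth1969Robinson`]
* M. Holmes-Cerfon, *Enumerating rigid sphere packings*, SIAM Rev. 58 (2016) 229–244 (the data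
  set of rigid clusters, `n = 13`). [`HolmesCerfon2016`]
* T. C. Hales, *A proof of Fejes Tóth's conjecture on sphere packings with kissing number twelve*,
  arXiv:1209.6043 (2012) (FCC/HCP patterns; the theorem `d < D` at `D ≥ 2.52`). [`Hales2012`]
-/

noncomputable section

namespace Summit.Ventures.Crystal3D

open Finset Literature.Geometry.DiscreteGeometry Summit.Ventures.Crystal3D.RobinsonShell
open Summit.AtomisticToContinuum.Crystallization.Theorems (isKissingConfig_of_isArrangedIn)

/-! ### Part A. Sets arranged in the FCC / HCP pattern have no pair at a distance in `(2, 2h₀)` -/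

/-- A set of points two of which are at a distance strictly between `2` and `2h₀ = 2.52` is
arranged neither in the FCC nor in the HCP pattern: a set arranged in either pattern is a kissing
configuration in Hales's sense (the tree's `isKissingConfig_of_isArrangedIn`, transporting
`isKissingConfig_fcc` / `isKissingConfig_hcp` along the isometry), whose distinct points are at
distance `2` or `≥ 2h₀` — for the cuboctahedron / anticuboctahedron of circumradius `2` in fact
`2` or `≥ 2√2`, "the least distance between the centers of non-abutting balls equals `√8`".
[cite: Hales2012, Definition 1 (separation `2h₀ = 2.52`); FejesToth1969Robinson p. 444 ("equals √8")] -/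
theorem not_isArrangedIn_fcc_hcp_of_dist {T : Set (EuclideanSpace ℝ (Fin 3))}
    {x y : EuclideanSpace ℝ (Fin 3)} (hx : x ∈ T) (hy : y ∈ T)
    (h2 : 2 < dist x y) (h0 : dist x y < 2 * hales_h0) :
    ¬ IsArrangedIn T fccKissingPattern ∧ ¬ IsArrangedIn T hcpKissingPattern := by
  have hxy : x ≠ y := by
    rintro rfl
    rw [dist_self] at h2
    norm_num at h2
  have key : ¬ (IsArrangedIn T fccKissingPattern ∨ IsArrangedIn T hcpKissingPattern) :=
    fun hor => absurd ((isKissingConfig_of_isArrangedIn hor).le_dist_of_ne hx hy hxy h2.ne')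
      (not_le.2 h0)
  exact ⟨fun h' => key (Or.inl h'), fun h' => key (Or.inr h')⟩

/-! ### Part B. The parameters `t = √19`, `r = √3`, `e = √6`, `p = √((67 − 15√19)/856)` -/

/-- `4.35889 < √19 < 4.3589`. -/
private theorem sqrt_nineteen_bounds : (4.35889 : ℝ) < Real.sqrt 19 ∧ Real.sqrt 19 < 4.3589 :=
  ⟨(Real.lt_sqrt (by norm_num)).2 (by norm_num), (Real.sqrt_lt' (by norm_num)).2 (by norm_num)⟩

/-- `7.54983 < √57 < 7.5499`. -/
private theorem sqrt_fiftyseven_bounds : (7.54983 : ℝ) < Real.sqrt 57 ∧ Real.sqrt 57 < 7.5499 :=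
  ⟨(Real.lt_sqrt (by norm_num)).2 (by norm_num), (Real.sqrt_lt' (by norm_num)).2 (by norm_num)⟩

/-- The four defining relations of the parameters: `t² = 19`, `r² = 3`, `e² = 6`,
`856 p² = 67 − 15 t` (note `67 − 15√19 > 0`). -/
private theorem rb_params :
    Real.sqrt 19 * Real.sqrt 19 = 19 ∧ Real.sqrt 3 * Real.sqrt 3 = 3 ∧
      Real.sqrt 6 * Real.sqrt 6 = 6 ∧
      856 * (Real.sqrt ((67 - 15 * Real.sqrt 19) / 856) * Real.sqrt ((67 - 15 * Real.sqrt 19) / 856))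
        = 67 - 15 * Real.sqrt 19 := by
  refine ⟨Real.mul_self_sqrt (by norm_num), Real.mul_self_sqrt (by norm_num),
    Real.mul_self_sqrt (by norm_num), ?_⟩
  have h := sqrt_nineteen_bounds
  rw [Real.mul_self_sqrt (by linarith)]
  ring

/-! ### Part C. The twelve points of `ℝ³` (radius `2`) and their distances -/

/-- Coordinates of the norm on `ℝ³`. -/
private theorem norm_vec3_eq_sqrt (a b c : ℝ) :
    ‖(!₂[a, b, c] : EuclideanSpace ℝ (Fin 3))‖ = Real.sqrt (a ^ 2 + b ^ 2 + c ^ 2) := by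
  rw [EuclideanSpace.norm_eq, Fin.sum_univ_three]
  simp [Real.norm_eq_abs, sq_abs]

/-- Coordinates of the distance on `ℝ³`. -/
private theorem dist_vec3_eq_sqrt (a b c a' b' c' : ℝ) :
    dist (!₂[a, b, c] : EuclideanSpace ℝ (Fin 3)) (!₂[a', b', c']) =
      Real.sqrt ((a - a') ^ 2 + (b - b') ^ 2 + (c - c') ^ 2) := by
  rw [EuclideanSpace.dist_eq, Fin.sum_univ_three]
  simp [Real.dist_eq, sq_abs]

section Points

variable {t r e p : ℝ}

/-- The twelve points lie on the sphere of radius `2`. -/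
private theorem norm_rbPt (ht : t * t = 19) (hr : r * r = 3) (he : e * e = 6)
    (hp : 856 * (p * p) = 67 - 15 * t) (i : Fin 12) : ‖rbPt t r e p i‖ = 2 := by
  rw [rbPt, norm_vec3_eq_sqrt]
  have h := rb_normSq ht hr he hp i
  rw [show (rbX t p i / 9) ^ 2 + (rbY r i / 9) ^ 2 + (rbZ t e p i / 9) ^ 2 = 2 ^ 2 by nlinarith]
  exact Real.sqrt_sq (by norm_num)

/-- The squared distance of two points of the table in terms of the three quadratic forms. -/
private theorem dist_rbPt_eq (i j : Fin 12) :
    dist (rbPt t r e p i) (rbPt t r e p j) =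
      Real.sqrt (((rbX t p i * rbX t p i + rbY r i * rbY r i + rbZ t e p i * rbZ t e p i) +
        (rbX t p j * rbX t p j + rbY r j * rbY r j + rbZ t e p j * rbZ t e p j) -
        2 * (rbX t p i * rbX t p j + rbY r i * rbY r j + rbZ t e p i * rbZ t e p j)) / 81) := by
  rw [rbPt, rbPt, dist_vec3_eq_sqrt]
  congr 1
  ring

/-- Abutting pairs are at distance exactly `2`. -/
private theorem dist_rbPt_of_adj (ht : t * t = 19) (hr : r * r = 3) (he : e * e = 6)
    (hp : 856 * (p * p) = 67 - 15 * t) {i j : Fin 12} (hij : rbAdj i j = true) :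
    dist (rbPt t r e p i) (rbPt t r e p j) = 2 := by
  rw [dist_rbPt_eq, rb_normSq ht hr he hp i, rb_normSq ht hr he hp j, rb_inner_of_adj ht hr he hp i j hij,
    show ((324 : ℝ) + 324 - 2 * 162) / 81 = 2 ^ 2 by norm_num]
  exact Real.sqrt_sq (by norm_num)

/-- Non-abutting pairs of distinct points are at distance `≥ √((928 − 80 t)/107)`. -/
private theorem le_dist_rbPt_of_not_adj (ht : t * t = 19) (hr : r * r = 3) (he : e * e = 6)
    (hp : 856 * (p * p) = 67 - 15 * t) (hlo : 4.35889 < t) (hhi : t < 4.3589) {i j : Fin 12}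
    (hij : i ≠ j) (hadj : rbAdj i j = false) :
    Real.sqrt ((928 - 80 * t) / 107) ≤ dist (rbPt t r e p i) (rbPt t r e p j) := by
  rw [dist_rbPt_eq, rb_normSq ht hr he hp i, rb_normSq ht hr he hp j]
  apply Real.sqrt_le_sqrt
  have h := rb_inner_of_not_adj ht hr he hp hlo hhi i j hij hadj
  linarith

/-- The pair `8, 9` (`C′, gC′`) is non-abutting and at distance exactly `√((928 − 80 t)/107)`. -/
private theorem dist_rbPt_eight_nine (ht : t * t = 19) (hr : r * r = 3) (he : e * e = 6)
    (hp : 856 * (p * p) = 67 - 15 * t) :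
    dist (rbPt t r e p 8) (rbPt t r e p 9) = Real.sqrt ((928 - 80 * t) / 107) := by
  rw [dist_rbPt_eq, rb_normSq ht hr he hp 8, rb_normSq ht hr he hp 9, rb_inner_eight_nine ht hr he hp]
  congr 1
  ring

/-- Every pair of distinct points is at distance `2` (abutting) or `≥ √((928 − 80t)/107)`;
in particular at distance `≥ 2`. -/
private theorem dist_rbPt_dichotomy (ht : t * t = 19) (hr : r * r = 3) (he : e * e = 6)
    (hp : 856 * (p * p) = 67 - 15 * t) (hlo : 4.35889 < t) (hhi : t < 4.3589) {i j : Fin 12}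
    (hij : i ≠ j) :
    dist (rbPt t r e p i) (rbPt t r e p j) = 2 ∨
      Real.sqrt ((928 - 80 * t) / 107) ≤ dist (rbPt t r e p i) (rbPt t r e p j) := by
  cases hadj : rbAdj i j
  · exact Or.inr (le_dist_rbPt_of_not_adj ht hr he hp hlo hhi hij hadj)
  · exact Or.inl (dist_rbPt_of_adj ht hr he hp hadj)

/-- `2 < √((928 − 80t)/107) < 2h₀ = 2.52` for `4.35889 < t < 4.3589` (indeed `≈ 2.3268`). -/
private theorem sqrt_bound_mem (hlo : (4.35889 : ℝ) < t) (hhi : t < 4.3589) :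
    2 < Real.sqrt ((928 - 80 * t) / 107) ∧ Real.sqrt ((928 - 80 * t) / 107) < 2 * hales_h0 := by
  constructor
  · rw [show (2 : ℝ) = Real.sqrt (2 ^ 2) by rw [Real.sqrt_sq (by norm_num)]]
    exact Real.sqrt_lt_sqrt (by norm_num) (by linarith)
  · rw [hales_h0_eq, show (2 : ℝ) * 1.26 = Real.sqrt (2.52 ^ 2) by
      rw [Real.sqrt_sq (by norm_num)]; norm_num]
    exact Real.sqrt_lt_sqrt (by linarith) (by linarith)

/-- The twelve points are pairwise distinct (pairwise distances `≥ 2`), so the table is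
injective. -/
private theorem rbPt_injective (ht : t * t = 19) (hr : r * r = 3) (he : e * e = 6)
    (hp : 856 * (p * p) = 67 - 15 * t) (hlo : 4.35889 < t) (hhi : t < 4.3589) :
    Function.Injective (rbPt t r e p) := by
  intro i j h
  by_contra hij
  have h2 := (sqrt_bound_mem hlo hhi).1
  rcases dist_rbPt_dichotomy ht hr he hp hlo hhi hij with hd | hd <;> rw [h, dist_self] at hd <;>
    linarith

end Points

/-! ### Part D. The theorems -/

/-- **Robinson's bound is exceeded: `√((42 − 2√57)/5) < √((928 − 80√19)/107)`**
(`2.31949… < 2.32678…`). [cite: FejesToth1969Robinson, p. 444 (the conjectured value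
`√((42 − 2√57)/5) ≈ 2.32`)] -/
theorem robinsonBound_lt :
    Real.sqrt ((42 - 2 * Real.sqrt 57) / 5) < Real.sqrt ((928 - 80 * Real.sqrt 19) / 107) := by
  have h19 := sqrt_nineteen_bounds
  have h57 := sqrt_fiftyseven_bounds
  exact Real.sqrt_lt_sqrt (by linarith) (by linarith)

/-- **Decimal bracket for Robinson's constant**: `2.3194 < √((42 − 2√57)/5) < 2.3195` (printed
"`≈ 2.32`"; least non-contact angle `70.8834°`). [cite: FejesToth1969Robinson, p. 444] -/
theorem robinsonBound_mem_Ioo :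
    Real.sqrt ((42 - 2 * Real.sqrt 57) / 5) ∈ Set.Ioo (2.3194 : ℝ) 2.3195 := by
  have h57 := sqrt_fiftyseven_bounds
  constructor
  · rw [show (2.3194 : ℝ) = Real.sqrt (2.3194 ^ 2) by rw [Real.sqrt_sq (by norm_num)]]
    exact Real.sqrt_lt_sqrt (by norm_num) (by nlinarith)
  · rw [show (2.3195 : ℝ) = Real.sqrt (2.3195 ^ 2) by rw [Real.sqrt_sq (by norm_num)]]
    exact Real.sqrt_lt_sqrt (by nlinarith) (by nlinarith)

/-- **Decimal bracket for the counterexample's least non-contact distance**: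
`2.3267 < √((928 − 80√19)/107) < 2.3268` (least non-contact angle `71.1397°`).
[cite: FejesToth1969Robinson, p. 444 (the quantity `d`)] -/
theorem rbMinDist_mem_Ioo :
    Real.sqrt ((928 - 80 * Real.sqrt 19) / 107) ∈ Set.Ioo (2.3267 : ℝ) 2.3268 := by
  have h19 := sqrt_nineteen_bounds
  constructor
  · rw [show (2.3267 : ℝ) = Real.sqrt (2.3267 ^ 2) by rw [Real.sqrt_sq (by norm_num)]]
    exact Real.sqrt_lt_sqrt (by norm_num) (by nlinarith)
  · rw [show (2.3268 : ℝ) = Real.sqrt (2.3268 ^ 2) by rw [Real.sqrt_sq (by norm_num)]]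
    exact Real.sqrt_lt_sqrt (by nlinarith) (by nlinarith)

/-- **The counterexample.** There is a set `S` of twelve points of the sphere of radius `2` about
`0` — the centres of twelve unit balls `u₁, …, u₁₂` touching the unit ball `u` at the origin, an
"arrangement of `u₁, …, u₁₂`" in the words of the source — which is arranged NEITHER in the FCC
pattern ("rhombic", cuboctahedral shell) NOR in the HCP pattern ("trapezo-rhombic",
anticuboctahedral shell), and in which any two distinct centres are at distance exactly `2` (the
balls abut) or at distance `≥ √((928 − 80√19)/107) = 2.32678…`, this value being attained by a
non-abutting pair: the least distance between centres of non-abutting balls is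
`d(S) = √((928 − 80√19)/107)`. (The set: the `D₂`-orbits of `A′/9, B′/9, C′/9` of the module
docstring; `22` abutting pairs; the shell of line 70530 of Holmes-Cerfon's `n13.txt`, in closed form.)
[cite: FejesToth1969Robinson, p. 444 (the problem "In a certain arrangement of `u₁, …, u₁₂`
other than the rhombic or trapezo-rhombic arrangement, let `d` be the least distance between the
centers of non-abutting balls")] -/
theorem exists_twelve_balls_nonAbutting_dist :
    ∃ S : Finset (EuclideanSpace ℝ (Fin 3)), S.card = 12 ∧ (∀ x ∈ S, ‖x‖ = 2) ∧
      (∀ x ∈ S, ∀ y ∈ S, x ≠ y →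
        dist x y = 2 ∨ Real.sqrt ((928 - 80 * Real.sqrt 19) / 107) ≤ dist x y) ∧
      (∃ x ∈ S, ∃ y ∈ S, dist x y = Real.sqrt ((928 - 80 * Real.sqrt 19) / 107)) ∧
      ¬ IsArrangedIn (S : Set (EuclideanSpace ℝ (Fin 3))) fccKissingPattern ∧
      ¬ IsArrangedIn (S : Set (EuclideanSpace ℝ (Fin 3))) hcpKissingPattern := by
  obtain ⟨ht, hr, he, hp⟩ := rb_params
  obtain ⟨hlo, hhi⟩ := sqrt_nineteen_bounds
  set P : Fin 12 → EuclideanSpace ℝ (Fin 3) :=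
    rbPt (Real.sqrt 19) (Real.sqrt 3) (Real.sqrt 6) (Real.sqrt ((67 - 15 * Real.sqrt 19) / 856))
    with hPdef
  have hinj : Function.Injective P := rbPt_injective ht hr he hp hlo hhi
  refine ⟨Finset.univ.image P, ?_, ?_, ?_, ?_, ?_⟩
  · rw [Finset.card_image_of_injective _ hinj, Finset.card_univ, Fintype.card_fin]
  · intro x hx
    obtain ⟨i, -, rfl⟩ := Finset.mem_image.1 hx
    exact norm_rbPt ht hr he hp i
  · intro x hx y hy hxy
    obtain ⟨i, -, rfl⟩ := Finset.mem_image.1 hx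
    obtain ⟨j, -, rfl⟩ := Finset.mem_image.1 hy
    have hij : i ≠ j := fun h => hxy (by rw [h])
    exact dist_rbPt_dichotomy ht hr he hp hlo hhi hij
  · exact ⟨P 8, Finset.mem_image_of_mem P (Finset.mem_univ _), P 9,
      Finset.mem_image_of_mem P (Finset.mem_univ _), dist_rbPt_eight_nine ht hr he hp⟩
  · have hb := sqrt_bound_mem hlo hhi
    have h89 := dist_rbPt_eight_nine ht hr he hp (r := Real.sqrt 3) (e := Real.sqrt 6)
    have hx : P 8 ∈ ((Finset.univ.image P : Finset (EuclideanSpace ℝ (Fin 3))) :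
        Set (EuclideanSpace ℝ (Fin 3))) := by
      rw [Finset.coe_image]
      exact ⟨8, by simp, rfl⟩
    have hy : P 9 ∈ ((Finset.univ.image P : Finset (EuclideanSpace ℝ (Fin 3))) :
        Set (EuclideanSpace ℝ (Fin 3))) := by
      rw [Finset.coe_image]
      exact ⟨9, by simp, rfl⟩
    exact not_isArrangedIn_fcc_hcp_of_dist hx hy (by rw [hPdef] at *; rw [h89]; exact hb.1)
      (by rw [hPdef] at *; rw [h89]; exact hb.2)

/-- **Robinson's conjecture (as reported by L. Fejes Tóth, 1969) is false.** "In a certain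
arrangement of `u₁, …, u₁₂` other than the rhombic or trapezo-rhombic arrangement, let `d` be the
least distance between the centers of non-abutting balls. […] Robinson made the conjecture that
the maximum of `d` is equal to `√((42 − 2√57)/5) ≈ 2.32`." — There is an arrangement of twelve
unit balls touching a unit ball (centres `S`, `|S| = 12`, on the sphere of radius `2`, pairwise
distances `≥ 2`), congruent neither to the FCC nor to the HCP arrangement, in which EVERY pair of
non-abutting balls has centre distance `> √((42 − 2√57)/5)` (indeed `≥ 2.3267 > 2.3195`); so
`max d ≥ √((928 − 80√19)/107) = 2.3267… > 2.3194… = √((42 − 2√57)/5)`.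
[cite: FejesToth1969Robinson, p. 444 (Robinson's conjecture `max d = √((42 − 2√57)/5)`; refuted)] -/
theorem exists_twelve_balls_nonAbutting_gt_robinsonBound :
    ∃ S : Finset (EuclideanSpace ℝ (Fin 3)), S.card = 12 ∧ (∀ x ∈ S, ‖x‖ = 2) ∧
      (∀ x ∈ S, ∀ y ∈ S, x ≠ y → 2 ≤ dist x y) ∧
      ¬ IsArrangedIn (S : Set (EuclideanSpace ℝ (Fin 3))) fccKissingPattern ∧
      ¬ IsArrangedIn (S : Set (EuclideanSpace ℝ (Fin 3))) hcpKissingPattern ∧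
      (∀ x ∈ S, ∀ y ∈ S, x ≠ y → dist x y ≠ 2 →
        Real.sqrt ((42 - 2 * Real.sqrt 57) / 5) < dist x y) := by
  obtain ⟨S, hcard, hnorm, hdist, -, hfcc, hhcp⟩ := exists_twelve_balls_nonAbutting_dist
  have hlt := robinsonBound_lt
  have h2 : (2 : ℝ) < Real.sqrt ((928 - 80 * Real.sqrt 19) / 107) := by
    have h := rbMinDist_mem_Ioo.1
    linarith
  refine ⟨S, hcard, hnorm, ?_, hfcc, hhcp, ?_⟩
  · intro x hx y hy hxy
    rcases hdist x hx y hy hxy with h | h <;> linarith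
  · intro x hx y hy hxy hne
    rcases hdist x hx y hy hxy with h | h
    · exact absurd h hne
    · exact lt_of_lt_of_le hlt h

end Summit.Ventures.Crystal3D

end
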